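import Literature.Barriers.ValiantsHypothesis.DepthReductionChasm
import Literature.Computability.AlgebraicComplexity.HomogeneousDepthFour
import Literature.Computability.AlgebraicComplexity.IMMInVPProofs
import Literature.Computability.AlgebraicComplexity.TavenasDepthFourProofs
import HarnessLib

/-!
# Barrier catalogue `ValiantsHypothesis`: the chasm at depth four AS PRINTED — Tavenas' depth
reduction is tight for `VP` against homogeneous `ΣΠΣΠ` (depth-4) circuits (Kumar–Saraf 2017,
Cor. 1.3); correction of the model of `DepthReductionChasm.lean`

D-0021 barrier entry, sibling of `DepthReductionChasm.lean` (route `ValiantsHypothesis/Depth4`),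
written by the provefact audit of `DepthReductionChasm` (2026-08-14), which found that fact
MIS-STATED relative to its source and not dischargeable; this file vendors the printed statement
under the new name `DepthReductionChasmDepthFour` and threads it to the dependents.

## The discrepancy

`DepthReductionChasm` (`DepthReductionChasm.lean`) renders Kumar–Saraf's Cor. 1.3 over the
tree's measure `homProductDepthCircuitSize 2` — homogeneous circuits of PRODUCT-DEPTH `≤ 2`.
That class allows a layer of sum gates below the bottom products (products of linear forms),
i.e. it is the class of homogeneous `ΣΠΣΠΣ` = homogeneous DEPTH-5 circuits
(`ArithCircuit.exists_productDepth_two_not_isDepthFour`, `HomogeneousDepthFour.lean`), whereas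
the source's "`ΣΠΣΠ` circuit" is "a circuit of depth 4 with the top layer and the third layer
only have sum gates and the second and the bottom layer have only product gates"
[cite: KumarSaraf2017, §3], bottom products multiplying leaves (eq. (3.1): `Q_{ij}` are sums of
monomials; the random-restriction step, Lemma 8.2, kills bottom MONOMIALS of large support). A
lower bound against the larger depth-5 class is a STRONGER assertion than print, and in the
regime of the chasm (`d = n`, `N = n^{O(1)}`, bound `n^{Ω(√n)}`) it is an open problem: over
finite fields only `exp(Ω_q(√d))` is proved for homogeneous depth-5 circuits, by a method that
needs `𝔽_q` [cite: KumarSaptharishi2017, Thm. 1] ("the obvious attempts to generalize the proofs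
in [KLSS, KS14] seem to fail for homogeneous depth-5 circuits", ibid. §1), and over
characteristic `0` the known bounds for homogeneous product-depth-`2` formulas are
`n^{Ω(√d)} / 2^{O(d)}`, superpolynomial only for `d ≤ log² n`
[cite: AmireddyGargKayalSahaThankey2023, Thm. 1.3 and Rem. 1.4], exponential bounds being open
"even for homogeneous depth-5 formulas"
[cite: AmireddyGargKayalSahaThankey2023, Open Problem 1.2].
Hence `DepthReductionChasm` (and the tree fact `kumar_saraf_imm_depth4` it rests on) is not
dischargeable from the literature as of this audit; it stays a named `Prop` (nothing asserted),
and every consequence drawn from it in the sibling file remains valid as an implication.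

The printed statement is vendored below as `DepthReductionChasmDepthFour`, over the depth-4
measure `homDepthFourCircuitSize` (`HomogeneousDepthFour.lean`, Kumar–Saraf's discipline
`ArithCircuit.IsDepthFour`): it is implied by `DepthReductionChasm` (depth-4 circuits are
product-depth-2 circuits), it follows from the printed Thm. 1.2
(`kumarSaraf2017_imm_homDepthFour`) and `IMM ∈ VP` — the latter now PROVED
(`isVPFamily_immPoly_holds`, `IMMInVPProofs.lean`), which also removes the `hVP` hypothesis of
`depthReductionChasm_of_kumarSaraf` — and it refutes the printed technique class
`ImprovedDepthReductionDepthFour` ("every degree-`n` `VP` family has homogeneous `ΣΠΣΠ` circuits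
of size `n^{o(√n)}`") by the same `n^{ε√n}`-versus-`n^{(ε/2)√n}` argument.

## Verdict clean-up (2026-08-15)

`DepthReductionChasm` is now `@[deprecated]` in the sibling `DepthReductionChasm.lean` (verdict:
mis-stated; this file's `DepthReductionChasmDepthFour` is its correction), and the sibling's
`ImprovedDepthReduction` is registered as an OPEN statement (`[status: open]`). The three
theorems below that are ABOUT the deprecated rendering and must name it —
`depthReductionChasm_of_kumarSaraf'`, `DepthReductionChasm.depthFour`,
`DepthReductionChasm.not_improvedDepthReductionDepthFour` — switch `linter.deprecated` off for
themselves only; nothing else changed.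

## Contents

* `depthReductionChasm_of_kumarSaraf'` — the sibling's derivation of `DepthReductionChasm` from
  `kumar_saraf_imm_depth4`, now without the `IMM ∈ VP` hypothesis (`isVPFamily_immPoly_holds`).
* `DepthReductionChasmDepthFour` (named `Prop`, BARRIER block) — Cor. 1.3 as printed, over
  `homDepthFourCircuitSize`; `DepthReductionChasm.depthFour` (old ⟹ printed);
  `depthReductionChasmDepthFour_of_kumarSaraf'` (from the printed Thm. 1.2,
  `kumarSaraf2017_imm_homDepthFour`, and the proved `IMM ∈ VP`).
* `ImprovedDepthReductionDepthFour` — the printed technique class (reduce `VP` to homogeneous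
  depth-4 circuits of size `n^{o(√n)}`), `ImprovedDepthReductionDepthFour.improvedDepthReduction`
  (printed class ⟹ tree class), and its refutations
  `DepthReductionChasmDepthFour.not_improvedDepthReductionDepthFour`,
  `DepthReductionChasm.not_improvedDepthReductionDepthFour`, `not_improvedDepthReductionDepthFour`.
* Technique class 2 of the sibling in the printed measure: `PolyMeasure.IsHomDepthFourSizeSound`
  (`μ ≤ homDepthFourCircuitSize`, WEAKER than the sibling's `IsHomDepthFourSound` since
  `homProductDepthCircuitSize 2 ≤ homDepthFourCircuitSize` — the realistic hypothesis: the
  published per-gate estimates of shifted-partials-type measures are for `ΣΠΣΠ` circuits) and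
  the UNCONDITIONAL chasm bound `PolyMeasure.depthFour_chasm_bound_of_vpSaturated` /
  `PolyMeasure.not_depthFour_witness_of_vpSaturated`, via Tavenas' theorem for the depth-4
  measure (`DepthReduction.homDepthFourCircuitSize_le_of_isVPFamily`,
  `TavenasDepthFourProofs.lean`, proved).

## References

* M. Kumar, S. Saraf, *On the power of homogeneous depth 4 arithmetic circuits*, SIAM J. Comput.
  46 (2017) 336–387 (FOCS 2014; arXiv:1404.1950): §1 pp. 2–3, §3 (model, eq. (3.1)), Thm. 1.2,
  Cor. 1.3, Lemma 4.1, Lemma 8.2, Thm. 8.10, §10.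
* M. Kumar, R. Saptharishi, *An exponential lower bound for homogeneous depth-5 circuits over
  finite fields*, CCC 2017 (LIPIcs 79) 31, Thm. 1, §1.
* P. Amireddy, A. Garg, N. Kayal, C. Saha, B. Thankey, *Low-depth arithmetic circuit lower bounds:
  bypassing set-multilinearization*, ICALP 2023 (LIPIcs 261) 12 (arXiv:2211.07691), Thm. 1.3,
  Rem. 1.4, Open Problems 1.1–1.2.
* S. Tavenas, *Improved bounds for reduction to depth 4 and depth 3*, Inform. and Comput. 240
  (2015) 2–11, Thm. 1.
-/

noncomputable section

namespace Literature.Barriers.ValiantsHypothesis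

open Literature.Computability.AlgebraicComplexity MvPolynomial


-- `linter.deprecated` off for the next declaration only (verdict clean-up 2026-08-15): it is
-- ABOUT the deprecated rendering `DepthReductionChasm` of the sibling file and must name it.
set_option linter.deprecated false in
/-- `IMM ∈ VP` is now a theorem of the tree (`isVPFamily_immPoly_holds`), so Cor. 1.3 in the
tree's product-depth-2 rendering follows from the tree's (open, stronger-than-print) `Prop`
`kumar_saraf_imm_depth4` alone. [cite: KumarSaraf2017, Thm. 1.2 and Cor. 1.3] -/
theorem depthReductionChasm_of_kumarSaraf' (hKS : kumar_saraf_imm_depth4) : DepthReductionChasm :=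
  depthReductionChasm_of_kumarSaraf hKS (isVPFamily_immPoly_holds ℂ)

/-- **Depth reduction is tight — Kumar–Saraf 2017, Cor. 1.3, AS PRINTED (depth-4 circuits)**,
over `ℂ`: "There exists a polynomial in `VP` of degree `n` in `N = n^{O(1)}` variables such that
any homogeneous `ΣΠΣΠ` circuit computing it has size at least `n^{Ω(√n)}`. In other words, the
upper bound in the depth reduction of Tavenas [Tav13] is tight, even when the bottom fan-in is
unbounded." Rendered with the depth-4 measure `homDepthFourCircuitSize` of
`HomogeneousDepthFour.lean` (homogeneous circuits in the `ΣΠΣΠ` layer discipline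
`ArithCircuit.IsDepthFour`, bottom products over leaves, gates counted): there is a `VP` family
`f` over `ℂ` of homogeneous degree-`n` polynomials and `ε > 0`, `n₀` with
`⌈n^{ε√n}⌉ ≤ homDepthFourCircuitSize (f n)` for all `n ≥ n₀`. This corrects `DepthReductionChasm`
(same cite), whose measure `homProductDepthCircuitSize 2` ranges over homogeneous depth-5
circuits (see the module docstring): `DepthReductionChasm → DepthReductionChasmDepthFour`
(`DepthReductionChasm.depthFour`), not conversely. Derived from the printed Thm. 1.2
(`depthReductionChasmDepthFour_of_kumarSaraf'`); consequence:
`DepthReductionChasmDepthFour.not_improvedDepthReductionDepthFour`.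

BARRIER
technique_class: depth-reduction, chasm-at-depth-four, improved-depth-reduction, homogeneous-depth-four-lower-bounds (as for `DepthReductionChasm`, restricted to depth-4 = `ΣΠΣΠ` circuits proper)
blocks: (i) the "improve the reduction" way to `ValiantsHypothesis` in its printed form `ImprovedDepthReductionDepthFour` — homogeneous `ΣΠΣΠ` (depth-4) circuits of size `n^{o(√n)}` for every homogeneous degree-`n` `VP` family over `ℂ` — which with the `n^{Ω(√n)}` homogeneous-`ΣΠΣΠ` bounds for explicit `VNP` families would separate `VP` from `VNP` [cite: KumarSaraf2017, §1 (p. 3)]; refuted: `DepthReductionChasmDepthFour.not_improvedDepthReductionDepthFour`; (ii) as in the sibling, every complexity-measure argument whose measure is sound for homogeneous DEPTH-4 size (`PolyMeasure.IsHomDepthFourSizeSound`) and `VP`-saturated at the permanent by a homogeneous `VP` family with slack `C` (`PolyMeasure.HomVPSaturated`) obeys `μ(per_n) ≤ (n+2)^{c√n+c}` UNCONDITIONALLY (`PolyMeasure.depthFour_chasm_bound_of_vpSaturated`, from Tavenas' theorem in the depth-4 measure, `DepthReduction.homDepthFourCircuitSize_le_of_isVPFamily`, proved) and so cannot certify an `(n+2)^{c√n+c}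 < ·` bound for every `c` (`PolyMeasure.not_depthFour_witness_of_vpSaturated`) [cite: KumarSaraf2017, Cor. 1.3 and §10 (Open problems)]; a fortiori nothing is blocked about reductions INTO homogeneous depth-5 (`ΣΠΣΠΣ`, product-depth 2 with bottom sums) circuits, for which no `n^{Ω(√n)}` lower bound is known (module docstring).
because: `IMM_{n⁵,n}` — the `(1,1)` entry (equivalently, up to a zero-substitution, the trace `immPoly (n^c) n`) of a product of `n` generic `n⁵ × n⁵` matrices — is in `VP` (PROVED: `isVPFamily_immPoly_holds`) and every homogeneous `ΣΠΣΠ` circuit computing it has size `2^{Ω(√n log n)}` over every field (random restrictions to bottom support `√n/64`, then the dimension of projected shifted partial derivatives: `≤ size · binomials` for the circuit by Lemma 4.1, large for restricted `IMM` by the leading-monomial count of §8) [cite: KumarSaraf2017, Thm. 8.10 and Lemma 8.2], while Tavenas computes every such family by homogeneous `ΣΠ^{[O(√d)]}ΣΠ^{[√d]}` circuits of size `n^{O(√d)}` [cite: Tavenas2015, Thm. 1]; so the exponent `Θ(√n) log n` of the reduction to depth four cannot be lowered for `VP` [cite: KumarSaraf2017, Cor. 1.3 and §10].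
evasions_known: as for `DepthReductionChasm`: none published for general `VP`; improved reductions remain possible for subclasses (regular formulas; possibly homogeneous formulas when reducing to general homogeneous `ΣΠΣΠ`) [cite: KumarSaraf2017, §10 (Open problems)]; and reducing to a RICHER target class than `ΣΠΣΠ` — e.g. homogeneous depth-5 — is not excluded by anything printed, since the matching lower bounds are open there [cite: AmireddyGargKayalSahaThankey2023, Open Problem 1.2].
scope_caveats: asymptotic (`∃ ε, n₀`), homogeneous depth-4 circuits, field `ℂ` here (print: every field); the tree's size is the gate count with free leaves and weighted sums, print counts nodes — the printed proof uses the circuit only through the normal form (3.1), `T ≤ size` and `#{bottom monomials} ≤ size`, all valid for `ArithCircuit.IsDepthFour` circuits, so the constant in `Ω` is all that may differ [cite: KumarSaraf2017, §3 and Thm. 8.10]; derived from the named fact `kumarSaraf2017_imm_homDepthFour` (Thm. 1.2 as printed, not discharged: a ~30-page probabilistic/combinatorial argument) and the proved `isVPFamily_immPoly_holds`, `immPoly_isHomogeneous_holds`; says nothing about inhomogeneous depth four or about depth five.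
status: theorem (established) [cite: KumarSaraf2017, Cor. 1.3] -/
def DepthReductionChasmDepthFour : Prop :=
  ∃ (σ : ℕ → Type) (_ : ∀ n, Fintype (σ n)) (f : ∀ n, MvPolynomial (σ n) ℂ),
    IsVPFamily f ∧ (∀ n, (f n).IsHomogeneous n) ∧ ∃ (n₀ : ℕ) (ε : ℝ), 0 < ε ∧
      ∀ n : ℕ, n₀ ≤ n →
        ((⌈(n : ℝ) ^ (ε * Real.sqrt n)⌉₊ : ℕ) : ℕ∞) ≤ homDepthFourCircuitSize (f n)

-- `linter.deprecated` off for the next declaration only (verdict clean-up 2026-08-15): it is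
-- ABOUT the deprecated rendering `DepthReductionChasm` of the sibling file and must name it.
set_option linter.deprecated false in
/-- The tree's (depth-5) rendering implies the printed (depth-4) statement: a lower bound for
homogeneous product-depth-2 circuits is one for the subclass of homogeneous depth-4 circuits
(`homProductDepthCircuitSize_two_le_homDepthFourCircuitSize`). [cite: KumarSaraf2017, Cor. 1.3] -/
theorem DepthReductionChasm.depthFour (h : DepthReductionChasm) : DepthReductionChasmDepthFour := by
  obtain ⟨σ, hσ, f, hf, hhom, n₀, ε, hε, hlow⟩ := h
  exact ⟨σ, hσ, f, hf, hhom, n₀, ε, hε, fun n hn =>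
    (hlow n hn).trans (homProductDepthCircuitSize_two_le_homDepthFourCircuitSize (f n))⟩

/-- **Cor. 1.3 from Thm. 1.2, as printed**: the depth-4 `IMM` fact
`kumarSaraf2017_imm_homDepthFour` at the field `ℂ`, homogeneity of `IMM_{m,d}` in degree `d`
(`immPoly_isHomogeneous_holds`) and `IMM ∈ VP` over `ℂ` (hypothesis `hVP`; discharged in the
primed version) give `DepthReductionChasmDepthFour` with the witness `n ↦ IMM_{n^c,n}`.
[cite: KumarSaraf2017, Thm. 1.2 and Cor. 1.3] -/
theorem depthReductionChasmDepthFour_of_kumarSaraf (hKS : kumarSaraf2017_imm_homDepthFour)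
    (hVP : ∀ c : ℕ, IsVPFamily (fun n => immPoly (n ^ c) n ℂ)) :
    DepthReductionChasmDepthFour := by
  obtain ⟨c, n₀, ε, hε, hlow⟩ := hKS ℂ
  exact ⟨fun n => Fin n × Fin (n ^ c) × Fin (n ^ c), inferInstance, fun n => immPoly (n ^ c) n ℂ,
    hVP c, fun n => immPoly_isHomogeneous_holds (k := ℂ) (n ^ c) n, n₀, ε, hε, hlow⟩

/-- **Cor. 1.3 from Thm. 1.2, as printed, with `IMM ∈ VP` proved** (`isVPFamily_immPoly_holds`):
the printed chasm is exactly as conditional as the printed Thm. 1.2.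
[cite: KumarSaraf2017, Thm. 1.2 and Cor. 1.3] -/
theorem depthReductionChasmDepthFour_of_kumarSaraf' (hKS : kumarSaraf2017_imm_homDepthFour) :
    DepthReductionChasmDepthFour :=
  depthReductionChasmDepthFour_of_kumarSaraf hKS (isVPFamily_immPoly_holds ℂ)

/-- **Technique class, printed form: an improved depth reduction to homogeneous `ΣΠΣΠ`
(depth-4) circuits over `ℂ`** — every `VP` family of homogeneous degree-`n` polynomials has,
for every `ε > 0` and all large `n`, homogeneous depth-4 circuits (`ArithCircuit.IsDepthFour`)
with at most `⌈n^{ε√n}⌉` gates. This is the reduction target of Agrawal–Vinay/Koiran/Tavenas and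
the class Kumar–Saraf's Cor. 1.3 speaks about ("can one improve upon the upper bounds obtained
by Koiran and Tavenas?"); it implies the tree's weaker-target class `ImprovedDepthReduction`
(`ImprovedDepthReductionDepthFour.improvedDepthReduction`).
[cite: KumarSaraf2017, §1 (pp. 2–3) and Cor. 1.3] -/
def ImprovedDepthReductionDepthFour : Prop :=
  ∀ {σ : ℕ → Type} [∀ n, Fintype (σ n)] (f : ∀ n, MvPolynomial (σ n) ℂ),
    IsVPFamily f → (∀ n, (f n).IsHomogeneous n) →
      ∀ ε : ℝ, 0 < ε → ∃ n₀ : ℕ, ∀ n : ℕ, n₀ ≤ n →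
        homDepthFourCircuitSize (f n) ≤ ((⌈(n : ℝ) ^ (ε * Real.sqrt n)⌉₊ : ℕ) : ℕ∞)

/-- Reducing into depth-4 circuits is reducing into product-depth-2 circuits: the printed class
implies the tree's class. [cite: KumarSaraf2017, §1 (p. 3)] -/
theorem ImprovedDepthReductionDepthFour.improvedDepthReduction
    (h : ImprovedDepthReductionDepthFour) : ImprovedDepthReduction := by
  intro σ _ f hf hhom ε hε
  obtain ⟨n₀, hn⟩ := h f hf hhom ε hε
  exact ⟨n₀, fun n hn' =>
    (homProductDepthCircuitSize_two_le_homDepthFourCircuitSize (f n)).trans (hn n hn')⟩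

/-- **The printed chasm refutes the printed improved depth reduction** (Kumar–Saraf 2017,
Cor. 1.3): a `VP` family needing homogeneous `ΣΠΣΠ` size `⌈n^{ε√n}⌉` cannot have such circuits
of size `⌈n^{(ε/2)√n}⌉`. [cite: KumarSaraf2017, Cor. 1.3] -/
theorem DepthReductionChasmDepthFour.not_improvedDepthReductionDepthFour
    (h : DepthReductionChasmDepthFour) : ¬ ImprovedDepthReductionDepthFour := by
  intro hI
  obtain ⟨σ, _, f, hf, hhom, n₀, ε, hε, hlow⟩ := h
  obtain ⟨n₁, hup⟩ := hI f hf hhom (ε / 2) (half_pos hε)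
  set n : ℕ := max (max n₀ n₁) (max 4 ⌈(2 / ε) ^ 2⌉₊) with hn
  have hn₀ : n₀ ≤ n := le_max_of_le_left (le_max_left _ _)
  have hn₁ : n₁ ≤ n := le_max_of_le_left (le_max_right _ _)
  have h4 : 4 ≤ n := le_max_of_le_right (le_max_left _ _)
  have hceil : ⌈(2 / ε) ^ 2⌉₊ ≤ n := le_max_of_le_right (le_max_right _ _)
  have hreal : (2 / ε) ^ 2 ≤ (n : ℝ) := Nat.ceil_le.1 hceil
  have h12 : ((⌈(n : ℝ) ^ (ε * Real.sqrt n)⌉₊ : ℕ) : ℕ∞) ≤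
      ((⌈(n : ℝ) ^ (ε / 2 * Real.sqrt n)⌉₊ : ℕ) : ℕ∞) := (hlow n hn₀).trans (hup n hn₁)
  have h12' : ⌈(n : ℝ) ^ (ε * Real.sqrt n)⌉₊ ≤ ⌈(n : ℝ) ^ (ε / 2 * Real.sqrt n)⌉₊ := by
    exact_mod_cast h12
  obtain ⟨htwo, hsq⟩ := two_le_rpow_half hε h4 hreal
  rw [hsq] at h12'
  have hlt := ceil_lt_ceil_mul_self htwo
  omega

-- `linter.deprecated` off for the next declaration only (verdict clean-up 2026-08-15): it is
-- ABOUT the deprecated rendering `DepthReductionChasm` of the sibling file and must name it.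
set_option linter.deprecated false in
/-- The tree's (stronger) chasm also refutes the printed class. [cite: KumarSaraf2017, Cor. 1.3] -/
theorem DepthReductionChasm.not_improvedDepthReductionDepthFour (h : DepthReductionChasm) :
    ¬ ImprovedDepthReductionDepthFour :=
  fun hI => h.not_improvedDepthReduction hI.improvedDepthReduction

/-- The refutation of the printed class directly from the printed Thm. 1.2 (and the proved
`IMM ∈ VP`). [cite: KumarSaraf2017, Cor. 1.3] -/
theorem not_improvedDepthReductionDepthFour (hKS : kumarSaraf2017_imm_homDepthFour) :
    ¬ ImprovedDepthReductionDepthFour :=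
  (depthReductionChasmDepthFour_of_kumarSaraf' hKS).not_improvedDepthReductionDepthFour

/-! ### Technique class 2 in the printed measure: depth-4-sound `VP`-saturated measures -/

namespace PolyMeasure

/-- `μ` is **sound for homogeneous depth-4 (`ΣΠΣΠ`) size**, the printed model:
`μ f ≤ homDepthFourCircuitSize f`. This is WEAKER than the sibling's `IsHomDepthFourSound`
(soundness for homogeneous product-depth-2 size, `IsHomDepthFourSound.isHomDepthFourSizeSound`)
and is the hypothesis the literature actually supplies: per-gate upper estimates of
(projected) shifted partials are proved for `ΣΠΣΠ` circuits (Kumar–Saraf 2017, Lemma 4.1),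
not for depth-5 ones. [cite: KumarSaraf2017, §4 (Lemma 4.1)] -/
def IsHomDepthFourSizeSound (μ : PolyMeasure) : Prop :=
  ∀ ⦃σ : Type⦄ [Fintype σ] (f : MvPolynomial σ ℂ), μ f ≤ homDepthFourCircuitSize f

/-- Soundness for homogeneous product-depth-2 size implies soundness for homogeneous depth-4
size (`homProductDepthCircuitSize 2 ≤ homDepthFourCircuitSize`). [folklore] -/
theorem IsHomDepthFourSound.isHomDepthFourSizeSound {μ : PolyMeasure} (h : μ.IsHomDepthFourSound) :
    μ.IsHomDepthFourSizeSound :=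
  fun _ _ f => (h f).trans (homProductDepthCircuitSize_two_le_homDepthFourCircuitSize f)

/-- **The printed chasm constrains depth-4-sound `VP`-saturated measures, unconditionally**: a
measure sound for homogeneous `ΣΠΣΠ` size and dominated on `per_n` by a homogeneous `VP` family
of degree `≤ n` up to the slack exponent `C` satisfies `μ(per_n) ≤ (n+2)^{c⌊√n⌋+c}` for some
`c`, all `n ≥ n₁` — by Tavenas' theorem in the depth-4 measure
(`DepthReduction.homDepthFourCircuitSize_le_of_isVPFamily`, proved), the mechanism of Cor. 1.3
read contrapositively. [cite: KumarSaraf2017, Cor. 1.3 and §10 (Open problems)] -/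
theorem depthFour_chasm_bound_of_vpSaturated {μ : PolyMeasure} (hμ : μ.IsHomDepthFourSizeSound)
    {C n₁ : ℕ} (hsat : μ.HomVPSaturated C n₁) :
    ∃ c : ℕ, ∀ n : ℕ, n₁ ≤ n → μ (perPoly (Fin n) ℂ) ≤ ((n + 2 : ℕ∞) ^ (c * Nat.sqrt n + c)) := by
  obtain ⟨σ, _, g, hg, hhom, hdeg, hle⟩ := hsat
  obtain ⟨c, hc⟩ := DepthReduction.homDepthFourCircuitSize_le_of_isVPFamily_complex g hg hhom
  refine ⟨C * c, fun n hn => (hle n hn).trans ?_⟩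
  rw [← chasmBound_pow]
  exact pow_le_pow_left' ((hμ (g n)).trans <| (hc n).trans <| chasmBound_mono (hdeg n) c n) C

/-- **Hence no witness for a super-chasm depth-4 lower bound on the permanent from such a
measure**: it is impossible that for every `c` some `n ≥ n₁` has `(n+2)^{c⌊√n⌋+c} < μ(per_n)`
(the shape of the route's homogeneous crux, read in the printed measure).
[cite: KumarSaraf2017, Cor. 1.3 and §10 (Open problems)] -/
theorem not_depthFour_witness_of_vpSaturated {μ : PolyMeasure} (hμ : μ.IsHomDepthFourSizeSound)
    {C n₁ : ℕ} (hsat : μ.HomVPSaturated C n₁) :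
    ¬ ∀ c : ℕ, ∃ n : ℕ, n₁ ≤ n ∧
      ((n + 2 : ℕ∞) ^ (c * Nat.sqrt n + c)) < μ (perPoly (Fin n) ℂ) := by
  obtain ⟨c, hc⟩ := depthFour_chasm_bound_of_vpSaturated hμ hsat
  intro h
  obtain ⟨n, hn, hlt⟩ := h c
  exact (not_lt.mpr (hc n hn)) hlt

/-- The sibling's conditional `hom_chasm_bound_of_vpSaturated` made unconditional: soundness for
homogeneous product-depth-2 size suffices a fortiori. [cite: KumarSaraf2017, Cor. 1.3] -/
theorem hom_chasm_bound_of_vpSaturated' {μ : PolyMeasure} (hμ : μ.IsHomDepthFourSound)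
    {C n₁ : ℕ} (hsat : μ.HomVPSaturated C n₁) :
    ∃ c : ℕ, ∀ n : ℕ, n₁ ≤ n → μ (perPoly (Fin n) ℂ) ≤ ((n + 2 : ℕ∞) ^ (c * Nat.sqrt n + c)) :=
  depthFour_chasm_bound_of_vpSaturated hμ.isHomDepthFourSizeSound hsat

/-- Non-vacuity of the class: the depth-4 size itself is a depth-4-sound measure. [folklore] -/
theorem isHomDepthFourSizeSound_size :
    IsHomDepthFourSizeSound (fun _ f => homDepthFourCircuitSize f) :=
  fun _ _ _ => le_rfl

end PolyMeasure

end Literature.Barriers.ValiantsHypothesis
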